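import Summits.BirchSwinnertonDyer.BirchSwinnertonDyer.Theorems.ClassRecordThreeRegCertKernelO3Log
import Summits.BirchSwinnertonDyer.BirchSwinnertonDyer.Theorems.ClassRecordThreeRegCertKernelO3FormalLog
import Summits.BirchSwinnertonDyer.BirchSwinnertonDyer.Theorems.ClassRecordThreeRegCertKernelO3Sigma
import Summits.BirchSwinnertonDyer.BirchSwinnertonDyer.Theorems.ClassRecordThreeRegCertKernelO2Height
import Summits.BirchSwinnertonDyer.BirchSwinnertonDyer.Theorems.ClassRecordThreeRegCertKernelO2Aux
import HarnessLib

/-!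
# Route `ClassRecordThree`, crux `SchneiderAtThree` (item 19106): the THIRD-ORDER kernel evaluator for the
# Stein–Wuthrich §4.2 height at `v₃(e(Q)) = 1` — `h mod 81` from a residue certificate `(r, γ, ζ, ℓ, ω, κ, u)`
# (cell `bsd-stepL`, seat `bsd-stepL-reg3-eng` g3; `--supports stmt-BirchSwinnertonDyer-19106`)

HONEST FRAMING: BSD is not proved by any of this; nothing here closes the crux; Schneider's conjecture (barrier
`PAdicHeightNondegeneracy`) is asserted NOWHERE. Third-order twin of `…O2Height` for REG3CERT rows with `v₃(e(Q)) = 1`,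
`v₃(h(Q)) = 3`: `r ≡ q (mod 9)` (`9 ∣ Δ − r·c₄³`), `γ ≡ C² (mod 81)` (§O3Log), `ζ ≡ z`, `ℓ ≡ log_Ŵ z (mod 3⁵)` (quartic
expansion, §O3FormalLog), `ω ≡ w`, `κ ≡ ch w − 1 (mod 3⁶)`, `Π ≡ 1 − 4rκ (mod 3⁴)` (§O3Sigma), `C²σ² ≡ 9u (mod 3⁶)`,
`9u = 2γκ(1 − 4rκ)`; the Iwasawa logarithms to three terms then give `h ≡ ½[(E − E²/2 + E³/3) − (U − U²/2 + U³/3)] (mod 81)`,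
`E = e'⁴ − 1`, `U = u² − 1`; CERTIFICATE **`3⁵ ∤ 6E − 3E² + 2E³ − 6U + 3U² − 2U³`** ⇒ `h ≠ 0`. Validated offline on all 690 rows
of kit j249075 with a stored point (`h mod 81` reproduced). Theorems only (0 defs, 0 facts).
References: [SteinWuthrich2013] §4.2; [Iwasawa1972PadicL] §4.4; [SilvermanATAEC1994] V.3, V.5; [SilvermanAEC2009] IV.6.
-/

open scoped Classical
open WeierstrassCurve Literature.NumberTheory.EllipticCurves
  Literature.NumberTheory.EllipticCurves.SteinWuthrich2013
  Summit.BirchSwinnertonDyer.Rank1Residual.X11b.RegMult.Rung62310y1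

namespace Summit.BirchSwinnertonDyer.Rank1Residual.X11b.RegMult.KernelCert

/-! ### §0 Plumbing -/
/-- Ultrametric inequality for differences. [folklore] -/
private theorem norm_sub_le_max₇ (a b : ℚ_[3]) : ‖a - b‖ ≤ max ‖a‖ ‖b‖ := by
  rw [sub_eq_add_neg, ← norm_neg b]; exact IsUltrametricDist.norm_add_le_max a (-b)

/-- `‖(2 : ℚ₃)⁻¹‖ = 1`. [folklore] -/
private theorem norm_inv_two₇ : ‖(2 : ℚ_[3])⁻¹‖ = 1 := by
  rw [norm_inv, show (2 : ℚ_[3]) = ((2 : ℤ) : ℚ_[3]) by norm_cast, norm_intCast_eq_one_of_not_dvd (by decide),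
    inv_one]

/-- `‖(m : ℚ₃)⁻¹‖ = 3ᵏ` for `m = u·3ᵏ`, `3 ∤ u`. [folklore] -/
private theorem norm_inv_natCast_eq' {m u k : ℕ} (hm : m = u * 3 ^ k) (hu : ¬ 3 ∣ u) :
    ‖((m : ℚ_[3]))⁻¹‖ = (3 : ℝ) ^ k := by
  have hun : ‖((u : ℤ) : ℚ_[3])‖ = 1 := norm_intCast_eq_one_of_not_dvd (by exact_mod_cast hu)
  rw [hm]; push_cast
  rw [mul_inv, norm_mul, norm_inv, show ((u : ℚ_[3])) = ((u : ℤ) : ℚ_[3]) by norm_cast, hun, inv_one, one_mul,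
    norm_inv, norm_pow, show (3 : ℚ_[3]) = ((3 : ℕ) : ℚ_[3]) by norm_cast, Padic.norm_p]
  simp

/-! ### §1 The formal logarithm and `w`, `ch w − 1` to third order -/

/-- **`log_Ŵ(z) ≡ ℓ (mod 3⁵)`** from `‖z − ζ‖ ≤ 3⁻⁵`, `‖z‖ ≤ 3⁻¹` and
`3⁶ ∣ 12ζ + 6a₁ζ² + 4(a₁²+a₂)ζ³ + 3(a₁³+2a₁a₂+2a₃)ζ⁴ − 12ℓ` (quartic expansion `norm_padicFormalLog_sub_quartic_le`).
[cite: SilvermanAEC2009, IV.6.4] -/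
theorem norm_padicFormalLog_sub_intCast_le_o3 (W : WeierstrassCurve ℚ) [W.IsGloballyMinimal] {a₁ a₂ a₃ ζ ℓ : ℤ}
    (ha1 : (W.baseChange ℚ_[3]).a₁ = a₁) (ha2 : (W.baseChange ℚ_[3]).a₂ = a₂) (ha3 : (W.baseChange ℚ_[3]).a₃ = a₃)
    (hℓ : (729 : ℤ) ∣ 12 * ζ + 6 * a₁ * ζ ^ 2 + 4 * (a₁ ^ 2 + a₂) * ζ ^ 3 + 3 * (a₁ ^ 3 + 2 * a₁ * a₂ + 2 * a₃) * ζ ^ 4 -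
      12 * ℓ) {z : ℚ_[3]} (hzζ : ‖z - ζ‖ ≤ 1 / 243) (hz : ‖z‖ ≤ 1 / 3) :
    ‖(W.baseChange ℚ_[3]).padicFormalLog z - ℓ‖ ≤ 1 / 243 := by
  set V := W.baseChange ℚ_[3] with hV
  have hq := norm_padicFormalLog_sub_quartic_le V hz
  rw [ha1, ha2, ha3] at hq
  have hζn : ‖(ζ : ℚ_[3])‖ ≤ 1 / 3 := by
    rw [show (ζ : ℚ_[3]) = z - (z - ζ) by ring]
    exact (norm_sub_le_max₇ _ _).trans (max_le hz (hzζ.trans (by norm_num)))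
  set Pz : ℚ_[3] := z + (2 : ℚ_[3])⁻¹ * a₁ * z ^ 2 + (3 : ℚ_[3])⁻¹ * (a₁ ^ 2 + a₂) * z ^ 3 +
    (4 : ℚ_[3])⁻¹ * (a₁ ^ 3 + 2 * a₁ * a₂ + 2 * a₃) * z ^ 4 with hPz
  set Pζ : ℚ_[3] := (ζ : ℚ_[3]) + (2 : ℚ_[3])⁻¹ * a₁ * (ζ : ℚ_[3]) ^ 2 + (3 : ℚ_[3])⁻¹ * (a₁ ^ 2 + a₂) * (ζ : ℚ_[3]) ^ 3 +
    (4 : ℚ_[3])⁻¹ * (a₁ ^ 3 + 2 * a₁ * a₂ + 2 * a₃) * (ζ : ℚ_[3]) ^ 4 with hPζ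
  have h3i : ‖(3 : ℚ_[3])⁻¹‖ = 3 := by
    rw [norm_inv, show (3 : ℚ_[3]) = ((3 : ℕ) : ℚ_[3]) by norm_cast, Padic.norm_p]; norm_num
  have h4i : ‖(4 : ℚ_[3])⁻¹‖ = 1 := by
    rw [norm_inv, show (4 : ℚ_[3]) = ((4 : ℤ) : ℚ_[3]) by norm_cast, norm_intCast_eq_one_of_not_dvd (by decide), inv_one]
  have ha1n : ‖(a₁ : ℚ_[3])‖ ≤ 1 := Padic.norm_int_le_one _
  have hA2 : ‖((a₁ : ℚ_[3])) ^ 2 + (a₂ : ℚ_[3])‖ ≤ 1 := by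
    have := Padic.norm_int_le_one (p := 3) (a₁ ^ 2 + a₂); push_cast at this; exact this
  have hA3 : ‖((a₁ : ℚ_[3])) ^ 3 + 2 * (a₁ : ℚ_[3]) * (a₂ : ℚ_[3]) + 2 * (a₃ : ℚ_[3])‖ ≤ 1 := by
    have := Padic.norm_int_le_one (p := 3) (a₁ ^ 3 + 2 * a₁ * a₂ + 2 * a₃); push_cast at this; exact this
  -- `P(z) − P(ζ) = (z − ζ)·[…]`, bracket of norm ≤ 1
  have hdiff : Pz - Pζ = (z - ζ) * (1 + (2 : ℚ_[3])⁻¹ * a₁ * (z + ζ) +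
      (3 : ℚ_[3])⁻¹ * (a₁ ^ 2 + a₂) * (z ^ 2 + z * ζ + (ζ : ℚ_[3]) ^ 2) +
      (4 : ℚ_[3])⁻¹ * (a₁ ^ 3 + 2 * a₁ * a₂ + 2 * a₃) * (z ^ 3 + z ^ 2 * ζ + z * (ζ : ℚ_[3]) ^ 2 + (ζ : ℚ_[3]) ^ 3)) := by
    rw [hPz, hPζ]; ring
  have hs1 : ‖z + ζ‖ ≤ 1 / 3 := (IsUltrametricDist.norm_add_le_max _ _).trans (max_le hz hζn)
  have hs2 : ‖z ^ 2 + z * ζ + (ζ : ℚ_[3]) ^ 2‖ ≤ 1 / 9 := by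
    refine (IsUltrametricDist.norm_add_le_max _ _).trans (max_le ((IsUltrametricDist.norm_add_le_max _ _).trans
      (max_le ?_ ?_)) ?_)
    · rw [norm_pow]; calc ‖z‖ ^ 2 ≤ (1 / 3) ^ 2 := by gcongr
        _ = 1 / 9 := by norm_num
    · rw [norm_mul]; calc ‖z‖ * ‖(ζ : ℚ_[3])‖ ≤ 1 / 3 * (1 / 3) := by gcongr
        _ = 1 / 9 := by norm_num
    · rw [norm_pow]; calc ‖(ζ : ℚ_[3])‖ ^ 2 ≤ (1 / 3) ^ 2 := by gcongr
        _ = 1 / 9 := by norm_num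
  have hs3 : ‖z ^ 3 + z ^ 2 * ζ + z * (ζ : ℚ_[3]) ^ 2 + (ζ : ℚ_[3]) ^ 3‖ ≤ 1 / 27 := by
    refine (IsUltrametricDist.norm_add_le_max _ _).trans (max_le ((IsUltrametricDist.norm_add_le_max _ _).trans
      (max_le ((IsUltrametricDist.norm_add_le_max _ _).trans (max_le ?_ ?_)) ?_)) ?_)
    · rw [norm_pow]; calc ‖z‖ ^ 3 ≤ (1 / 3) ^ 3 := by gcongr
        _ = 1 / 27 := by norm_num
    · rw [norm_mul, norm_pow]; calc ‖z‖ ^ 2 * ‖(ζ : ℚ_[3])‖ ≤ (1 / 3) ^ 2 * (1 / 3) := by gcongr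
        _ = 1 / 27 := by norm_num
    · rw [norm_mul, norm_pow]; calc ‖z‖ * ‖(ζ : ℚ_[3])‖ ^ 2 ≤ 1 / 3 * (1 / 3) ^ 2 := by gcongr
        _ = 1 / 27 := by norm_num
    · rw [norm_pow]; calc ‖(ζ : ℚ_[3])‖ ^ 3 ≤ (1 / 3) ^ 3 := by gcongr
        _ = 1 / 27 := by norm_num
  have hbr : ‖1 + (2 : ℚ_[3])⁻¹ * a₁ * (z + ζ) + (3 : ℚ_[3])⁻¹ * (a₁ ^ 2 + a₂) * (z ^ 2 + z * ζ + (ζ : ℚ_[3]) ^ 2) +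
      (4 : ℚ_[3])⁻¹ * (a₁ ^ 3 + 2 * a₁ * a₂ + 2 * a₃) * (z ^ 3 + z ^ 2 * ζ + z * (ζ : ℚ_[3]) ^ 2 + (ζ : ℚ_[3]) ^ 3)‖ ≤ 1 := by
    refine (IsUltrametricDist.norm_add_le_max _ _).trans (max_le ((IsUltrametricDist.norm_add_le_max _ _).trans
      (max_le ((IsUltrametricDist.norm_add_le_max _ _).trans (max_le (by rw [norm_one]) ?_)) ?_)) ?_)
    · rw [norm_mul, norm_mul, norm_inv_two₇]
      calc 1 * ‖(a₁ : ℚ_[3])‖ * ‖z + ζ‖ ≤ 1 * 1 * (1 / 3) := by gcongr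
        _ ≤ 1 := by norm_num
    · rw [norm_mul, norm_mul, h3i]
      calc 3 * ‖((a₁ : ℚ_[3])) ^ 2 + (a₂ : ℚ_[3])‖ * ‖z ^ 2 + z * ζ + (ζ : ℚ_[3]) ^ 2‖ ≤ 3 * 1 * (1 / 9) := by gcongr
        _ ≤ 1 := by norm_num
    · rw [norm_mul, norm_mul, h4i]
      calc 1 * ‖((a₁ : ℚ_[3])) ^ 3 + 2 * (a₁ : ℚ_[3]) * (a₂ : ℚ_[3]) + 2 * (a₃ : ℚ_[3])‖ *
          ‖z ^ 3 + z ^ 2 * ζ + z * (ζ : ℚ_[3]) ^ 2 + (ζ : ℚ_[3]) ^ 3‖ ≤ 1 * 1 * (1 / 27) := by gcongr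
        _ ≤ 1 := by norm_num
  have hstep2 : ‖Pz - Pζ‖ ≤ 1 / 243 := by
    rw [hdiff, norm_mul]
    calc ‖z - ζ‖ * _ ≤ 1 / 243 * 1 := by gcongr
      _ = 1 / 243 := mul_one _
  have hstep3 : ‖Pζ - ℓ‖ ≤ 1 / 243 := by
    have h : Pζ - ℓ = (12 : ℚ_[3])⁻¹ * (((12 * ζ + 6 * a₁ * ζ ^ 2 + 4 * (a₁ ^ 2 + a₂) * ζ ^ 3 +
        3 * (a₁ ^ 3 + 2 * a₁ * a₂ + 2 * a₃) * ζ ^ 4 - 12 * ℓ : ℤ) : ℚ_[3])) := by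
      have h2 : (2 : ℚ_[3]) ≠ 0 := by norm_num
      have h3 : (3 : ℚ_[3]) ≠ 0 := by norm_num
      have h4 : (4 : ℚ_[3]) ≠ 0 := by norm_num
      have h12 : (12 : ℚ_[3]) ≠ 0 := by norm_num
      rw [hPζ]; push_cast; field_simp; ring
    have h12n : ‖(12 : ℚ_[3])⁻¹‖ = 3 := by
      rw [show (12 : ℚ_[3]) = ((12 : ℕ) : ℚ_[3]) by norm_cast]
      have := norm_inv_natCast_eq' (m := 12) (u := 4) (k := 1) (by norm_num) (by norm_num)
      rw [this, pow_one]
    rw [h, norm_mul, h12n]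
    calc 3 * ‖(((12 * ζ + 6 * a₁ * ζ ^ 2 + 4 * (a₁ ^ 2 + a₂) * ζ ^ 3 + 3 * (a₁ ^ 3 + 2 * a₁ * a₂ + 2 * a₃) * ζ ^ 4 -
        12 * ℓ : ℤ) : ℚ_[3]))‖ ≤ 3 * (1 / 729) := by
          gcongr; exact (norm_intCast_le_of_pow_dvd (k := 6) (by norm_num; exact hℓ)).trans (by norm_num)
      _ = 1 / 243 := by norm_num
  rw [show V.padicFormalLog z - ℓ = (V.padicFormalLog z - Pz) + (Pz - Pζ) + (Pζ - ℓ) by ring]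
  refine (IsUltrametricDist.norm_add_le_max _ _).trans (max_le ?_ hstep3)
  exact (IsUltrametricDist.norm_add_le_max _ _).trans (max_le hq hstep2)

/-! ### §2 `w`, `ch w − 1`, `Π`, `C²σ²` to third order, and the Iwasawa logarithm modulo `81` -/

/-- `w ≡ ω`, `ch w − 1 ≡ κ (mod 3⁶)`, `Π ≡ 1 − 4rκ (mod 3⁴)` and **`C²σ² ≡ 9u (mod 3⁶)`**, `9u = 2γκ(1 − 4rκ)`. [folklore] -/
theorem norm_mul_tateSigmaSq_sub_le_o3 {q L C2 : ℚ_[3]} {r ℓ γ ω κ u : ℤ} (hqr : ‖q - r‖ ≤ 1 / 9) (hq : ‖q‖ ≤ 1 / 3)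
    (hL : ‖L - ℓ‖ ≤ 1 / 243) (hℓ : ‖(ℓ : ℚ_[3])‖ ≤ 1 / 3) (hC : ‖C2 - γ‖ ≤ 1 / 81) (h3γ : ¬ (3 : ℤ) ∣ γ)
    (hω9 : (9 : ℤ) ∣ ω) (hω : (729 : ℤ) ∣ ℓ ^ 2 - ω * γ) (hκ9 : (9 : ℤ) ∣ κ)
    (hκ : (6561 : ℤ) ∣ 360 * ω + 30 * ω ^ 2 + ω ^ 3 - 720 * κ) (hu : 9 * u = 2 * γ * κ * (1 - 4 * r * κ)) :
    ‖C2 * tateSigmaSq q (coshOfSq (L ^ 2 / C2)) - 9 * u‖ ≤ 1 / 729 := by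
  have hγn : ‖(γ : ℚ_[3])‖ = 1 := norm_intCast_eq_one_of_not_dvd h3γ
  have hCn : ‖C2‖ = 1 := by
    rw [← hγn]; exact Padic.norm_eq_of_norm_sub_lt_right (hC.trans_lt (by rw [hγn]; norm_num))
  have hC0 : C2 ≠ 0 := by intro h; rw [h, norm_zero] at hCn; exact zero_ne_one hCn
  have hωn : ‖(ω : ℚ_[3])‖ ≤ 1 / 9 := (norm_intCast_le_of_pow_dvd (k := 2) (by norm_num; exact hω9)).trans (by norm_num)
  have hκn : ‖(κ : ℚ_[3])‖ ≤ 1 / 9 := (norm_intCast_le_of_pow_dvd (k := 2) (by norm_num; exact hκ9)).trans (by norm_num)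
  have hrn : ‖(r : ℚ_[3])‖ ≤ 1 := Padic.norm_int_le_one _
  have hLn : ‖L‖ ≤ 1 / 3 := by
    rw [show L = (L - ℓ) + ℓ by ring]; exact (IsUltrametricDist.norm_add_le_max _ _).trans (max_le (hL.trans (by norm_num)) hℓ)
  -- `w ≡ ω (mod 3⁶)`
  have hw : ‖L ^ 2 / C2 - ω‖ ≤ 1 / 729 := by
    rw [div_sub' hC0, norm_div, hCn, div_one]
    have : L ^ 2 - C2 * ω = (L - ℓ) * (L + ℓ) + (((ℓ ^ 2 - ω * γ : ℤ) : ℚ_[3])) + -((ω : ℚ_[3]) * (C2 - γ)) := by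
      push_cast; ring
    rw [this]
    refine (IsUltrametricDist.norm_add_le_max _ _).trans (max_le ((IsUltrametricDist.norm_add_le_max _ _).trans
      (max_le ?_ ?_)) ?_)
    · rw [norm_mul]
      calc ‖L - ℓ‖ * ‖L + ℓ‖ ≤ 1 / 243 * (1 / 3) := by
            gcongr; exact (IsUltrametricDist.norm_add_le_max _ _).trans (max_le hLn hℓ)
        _ = 1 / 729 := by norm_num
    · exact (norm_intCast_le_of_pow_dvd (k := 6) (by norm_num; exact hω)).trans (by norm_num)
    · rw [norm_neg, norm_mul]
      calc ‖(ω : ℚ_[3])‖ * ‖C2 - γ‖ ≤ 1 / 9 * (1 / 81) := by gcongr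
        _ = 1 / 729 := by norm_num
  -- `c − 1 ≡ κ (mod 3⁶)` (cubic cosh)
  set w := L ^ 2 / C2 with hwdef
  have hwn : ‖w‖ ≤ 1 / 9 := by
    rw [show w = (w - ω) + ω by ring]; exact (IsUltrametricDist.norm_add_le_max _ _).trans (max_le (hw.trans (by norm_num)) hωn)
  have hcosh := norm_coshOfSq_sub_cubic_le hwn
  have h24 : ‖(24 : ℚ_[3])⁻¹‖ = 3 := by
    rw [show (24 : ℚ_[3]) = ((24 : ℕ) : ℚ_[3]) by norm_cast]
    have := norm_inv_natCast_eq' (m := 24) (u := 8) (k := 1) (by norm_num) (by norm_num); rw [this, pow_one]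
  have h720 : ‖(720 : ℚ_[3])⁻¹‖ = 9 := by
    rw [show (720 : ℚ_[3]) = ((720 : ℕ) : ℚ_[3]) by norm_cast]
    have := norm_inv_natCast_eq' (m := 720) (u := 80) (k := 2) (by norm_num) (by norm_num); rw [this]; norm_num
  set c := coshOfSq w with hc
  have hc1 : ‖(c - 1) - κ‖ ≤ 1 / 729 := by
    have hsplit : (c - 1) - κ = (c - (1 + w / 2 + w ^ 2 / 24 + w ^ 3 / 720)) +
        (w - ω) * ((2 : ℚ_[3])⁻¹ + (24 : ℚ_[3])⁻¹ * (w + ω) + (720 : ℚ_[3])⁻¹ * (w ^ 2 + w * ω + (ω : ℚ_[3]) ^ 2)) +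
        (720 : ℚ_[3])⁻¹ * (((360 * ω + 30 * ω ^ 2 + ω ^ 3 - 720 * κ : ℤ) : ℚ_[3])) := by
      have h2 : (2 : ℚ_[3]) ≠ 0 := by norm_num
      have h24' : (24 : ℚ_[3]) ≠ 0 := by norm_num
      have h720' : (720 : ℚ_[3]) ≠ 0 := by norm_num
      push_cast; field_simp; ring
    rw [hsplit]
    have hwω : ‖w + ω‖ ≤ 1 / 9 := (IsUltrametricDist.norm_add_le_max _ _).trans (max_le hwn hωn)
    have hq2 : ‖w ^ 2 + w * ω + (ω : ℚ_[3]) ^ 2‖ ≤ 1 / 81 := by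
      refine (IsUltrametricDist.norm_add_le_max _ _).trans (max_le ((IsUltrametricDist.norm_add_le_max _ _).trans
        (max_le ?_ ?_)) ?_)
      · rw [norm_pow]; calc ‖w‖ ^ 2 ≤ (1 / 9) ^ 2 := by gcongr
          _ = 1 / 81 := by norm_num
      · rw [norm_mul]; calc ‖w‖ * ‖(ω : ℚ_[3])‖ ≤ 1 / 9 * (1 / 9) := by gcongr
          _ = 1 / 81 := by norm_num
      · rw [norm_pow]; calc ‖(ω : ℚ_[3])‖ ^ 2 ≤ (1 / 9) ^ 2 := by gcongr
          _ = 1 / 81 := by norm_num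
    have hbr : ‖(2 : ℚ_[3])⁻¹ + (24 : ℚ_[3])⁻¹ * (w + ω) + (720 : ℚ_[3])⁻¹ * (w ^ 2 + w * ω + (ω : ℚ_[3]) ^ 2)‖ ≤ 1 := by
      refine (IsUltrametricDist.norm_add_le_max _ _).trans (max_le ((IsUltrametricDist.norm_add_le_max _ _).trans
        (max_le (by rw [norm_inv_two₇]) ?_)) ?_)
      · rw [norm_mul, h24]; calc 3 * ‖w + ω‖ ≤ 3 * (1 / 9) := by gcongr
          _ ≤ 1 := by norm_num
      · rw [norm_mul, h720]; calc 9 * ‖w ^ 2 + w * ω + (ω : ℚ_[3]) ^ 2‖ ≤ 9 * (1 / 81) := by gcongr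
          _ ≤ 1 := by norm_num
    refine (IsUltrametricDist.norm_add_le_max _ _).trans (max_le ((IsUltrametricDist.norm_add_le_max _ _).trans
      (max_le (hcosh.trans ?_) ?_)) ?_)
    · calc 9 * ‖w‖ ^ 4 ≤ 9 * (1 / 9) ^ 4 := by gcongr
        _ = 1 / 729 := by norm_num
    · rw [norm_mul]; calc ‖w - ω‖ * _ ≤ 1 / 729 * 1 := by gcongr
        _ = 1 / 729 := mul_one _
    · rw [norm_mul, h720]
      calc 9 * ‖(((360 * ω + 30 * ω ^ 2 + ω ^ 3 - 720 * κ : ℤ) : ℚ_[3]))‖ ≤ 9 * (1 / 6561) := by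
            gcongr; exact (norm_intCast_le_of_pow_dvd (k := 8) (by norm_num; exact hκ)).trans (by norm_num)
        _ = 1 / 729 := by norm_num
  have hc1n : ‖c - 1‖ ≤ 1 / 9 := by
    rw [show c - 1 = ((c - 1) - κ) + κ by ring]
    exact (IsUltrametricDist.norm_add_le_max _ _).trans (max_le (hc1.trans (by norm_num)) hκn)
  have hcn : ‖c‖ ≤ 1 := by
    rw [show c = (c - 1) + 1 by ring]
    exact (IsUltrametricDist.norm_add_le_max _ _).trans (max_le (hc1n.trans (by norm_num)) (by rw [norm_one]))
  -- `Π ≡ 1 − 4rκ (mod 3⁴)`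
  have hq1 : ‖q‖ < 1 := hq.trans_lt (by norm_num)
  have hPi := norm_tprod_tateSigmaSq_factor_sub_linear_le hq1 hcn
  set P := ∏' n : ℕ, (1 - 2 * q ^ (n + 1) * c + q ^ (2 * (n + 1))) ^ 2 / (1 - q ^ (n + 1)) ^ 4 with hPdef
  have hπ : ‖P - (1 - 4 * r * κ)‖ ≤ 1 / 81 := by
    rw [show P - (1 - 4 * (r : ℚ_[3]) * κ) = (P - (1 - 4 * q * (c - 1))) +
      (-(4 : ℚ_[3])) * ((q - r) * (c - 1) + r * ((c - 1) - κ)) by ring]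
    refine (IsUltrametricDist.norm_add_le_max _ _).trans (max_le (hPi.trans ?_) ?_)
    · calc ‖q‖ ^ 2 * ‖c - 1‖ ≤ (1 / 3) ^ 2 * (1 / 9) := by gcongr
        _ = 1 / 81 := by norm_num
    · rw [norm_mul, norm_neg, show (4 : ℚ_[3]) = ((4 : ℤ) : ℚ_[3]) by norm_cast]
      calc ‖((4 : ℤ) : ℚ_[3])‖ * ‖(q - r) * (c - 1) + r * ((c - 1) - κ)‖ ≤ 1 * (1 / 81) := by
            gcongr
            · exact Padic.norm_int_le_one _
            · refine (IsUltrametricDist.norm_add_le_max _ _).trans (max_le ?_ ?_)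
              · rw [norm_mul]; calc ‖q - r‖ * ‖c - 1‖ ≤ 1 / 9 * (1 / 9) := by gcongr
                  _ = 1 / 81 := by norm_num
              · rw [norm_mul]; calc ‖(r : ℚ_[3])‖ * ‖(c - 1) - κ‖ ≤ 1 * (1 / 729) := by gcongr
                  _ ≤ 1 / 81 := by norm_num
        _ = 1 / 81 := one_mul _
  -- `σ² = 2(c − 1)Π ≡ 2κπ`, `C²σ² ≡ 9u`
  have hdef : tateSigmaSq q c = 2 * (c - 1) * P := by rw [tateSigmaSq]
  have h2 : ‖(2 : ℚ_[3])‖ ≤ 1 := by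
    rw [show (2 : ℚ_[3]) = ((2 : ℤ) : ℚ_[3]) by norm_cast]; exact Padic.norm_int_le_one _
  have h9u : (9 : ℚ_[3]) * u = 2 * γ * κ * (1 - 4 * r * κ) := by exact_mod_cast hu
  have hπn : ‖(1 : ℚ_[3]) - 4 * r * κ‖ ≤ 1 := by
    refine (norm_sub_le_max₇ _ _).trans (max_le (by rw [norm_one]) ?_)
    rw [norm_mul, norm_mul, show (4 : ℚ_[3]) = ((4 : ℤ) : ℚ_[3]) by norm_cast]
    calc ‖((4 : ℤ) : ℚ_[3])‖ * ‖(r : ℚ_[3])‖ * ‖(κ : ℚ_[3])‖ ≤ 1 * 1 * (1 / 9) := by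
          gcongr; exact Padic.norm_int_le_one _
      _ ≤ 1 := by norm_num
  rw [hdef, show C2 * (2 * (c - 1) * P) - 9 * u =
    2 * C2 * (c - 1) * (P - (1 - 4 * r * κ)) + 2 * C2 * ((c - 1) - κ) * (1 - 4 * r * κ) +
    2 * κ * (1 - 4 * r * κ) * (C2 - γ) by rw [h9u]; ring]
  refine (IsUltrametricDist.norm_add_le_max _ _).trans (max_le ((IsUltrametricDist.norm_add_le_max _ _).trans
    (max_le ?_ ?_)) ?_)
  · rw [norm_mul, norm_mul, norm_mul, hCn]
    calc ‖(2 : ℚ_[3])‖ * 1 * ‖c - 1‖ * ‖P - (1 - 4 * r * κ)‖ ≤ 1 * 1 * (1 / 9) * (1 / 81) := by gcongr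
      _ = 1 / 729 := by norm_num
  · rw [norm_mul, norm_mul, norm_mul, hCn]
    calc ‖(2 : ℚ_[3])‖ * 1 * ‖(c - 1) - κ‖ * ‖(1 : ℚ_[3]) - 4 * r * κ‖ ≤ 1 * 1 * (1 / 729) * 1 := by gcongr
      _ = 1 / 729 := by norm_num
  · rw [norm_mul, norm_mul, norm_mul]
    calc ‖(2 : ℚ_[3])‖ * ‖(κ : ℚ_[3])‖ * ‖(1 : ℚ_[3]) - 4 * r * κ‖ * ‖C2 - γ‖ ≤ 1 * (1 / 9) * 1 * (1 / 81) := by gcongr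
      _ = 1 / 729 := by norm_num

/-- **`‖Y − 9u‖₃ ≤ 3⁻⁶`, `3 ∤ u ⇒ ‖log₃ Y − ½(U − U²/2 + U³/3)‖₃ ≤ 3⁻⁴`, `U = u² − 1`** (as `…_o2`, one digit further; the
three-term Iwasawa truncation still suffices: `‖T‖⁴ ≤ 3⁻⁴`). [cite: Iwasawa1972PadicL, §4.4] -/
theorem norm_padicLog_sub_le_of_norm_sub_le_o3 {Y : ℚ_[3]} {u : ℤ} (h3u : ¬ (3 : ℤ) ∣ u) (h3u2 : (3 : ℤ) ∣ u ^ 2 - 1)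
    (hY : ‖Y - 9 * u‖ ≤ 1 / 729) :
    ‖padicLog 3 Y - (2 : ℚ_[3])⁻¹ * ((((u ^ 2 - 1 : ℤ)) : ℚ_[3]) - (((u ^ 2 - 1 : ℤ)) : ℚ_[3]) ^ 2 / 2 +
      (((u ^ 2 - 1 : ℤ)) : ℚ_[3]) ^ 3 / 3)‖ ≤ 1 / 81 := by
  have hun : ‖(u : ℚ_[3])‖ = 1 := norm_intCast_eq_one_of_not_dvd h3u
  have h9 : ‖(9 : ℚ_[3])‖ = 1 / 9 := by
    rw [show (9 : ℚ_[3]) = (3 : ℚ_[3]) ^ (2 : ℤ) by norm_num, show (3 : ℚ_[3]) = ((3 : ℕ) : ℚ_[3]) by norm_cast,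
      Padic.norm_p_zpow]; norm_num
  have h9u : ‖(9 : ℚ_[3]) * u‖ = 1 / 9 := by rw [norm_mul, h9, hun, mul_one]
  have hYn : ‖Y‖ = 1 / 9 := by
    rw [← h9u]; exact Padic.norm_eq_of_norm_sub_lt_right (hY.trans_lt (by rw [h9u]; norm_num))
  have hY0 : Y ≠ 0 := by intro h; rw [h, norm_zero] at hYn; norm_num at hYn
  rw [show padicLog 3 Y = (2 : ℚ_[3])⁻¹ * padicLogSeries 3 ((Y * (3 : ℚ_[3]) ^ (-(2 : ℤ))) ^ 2) by
    rw [padicLog_of_ne_zero hY0, valuation_eq_of_norm_eq hY0 (n := 2) (by rw [hYn]; norm_num)]; norm_num]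
  set t : ℚ_[3] := Y * (3 : ℚ_[3]) ^ (-(2 : ℤ)) with ht
  have htu : t - u = (Y - 9 * u) * (3 : ℚ_[3]) ^ (-(2 : ℤ)) := by
    rw [ht, zpow_neg, zpow_two]; field_simp; ring
  have h3m2 : ‖(3 : ℚ_[3]) ^ (-(2 : ℤ))‖ = 9 := by
    rw [show (3 : ℚ_[3]) = ((3 : ℕ) : ℚ_[3]) by norm_cast, Padic.norm_p_zpow]; norm_num
  have htun : ‖t - u‖ ≤ 1 / 81 := by
    rw [htu, norm_mul, h3m2]
    calc ‖Y - 9 * u‖ * 9 ≤ 1 / 729 * 9 := by gcongr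
      _ = 1 / 81 := by norm_num
  have htu1 : ‖t + u‖ ≤ 1 := by
    rw [show t + u = (t - u) + 2 * u by ring]
    refine (IsUltrametricDist.norm_add_le_max _ _).trans (max_le (htun.trans (by norm_num)) ?_)
    rw [show (2 : ℚ_[3]) * u = ((2 * u : ℤ) : ℚ_[3]) by push_cast; ring]; exact Padic.norm_int_le_one _
  set T : ℚ_[3] := 1 - t ^ 2 with hT
  set T0 : ℚ_[3] := 1 - (u : ℚ_[3]) ^ 2 with hT0
  have hTT0 : ‖T - T0‖ ≤ 1 / 81 := by
    rw [show T - T0 = -((t - u) * (t + u)) by rw [hT, hT0]; ring, norm_neg, norm_mul]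
    calc ‖t - u‖ * ‖t + u‖ ≤ 1 / 81 * 1 := by gcongr
      _ = 1 / 81 := mul_one _
  have hT0n : ‖T0‖ ≤ 1 / 3 := by
    rw [hT0, show (1 : ℚ_[3]) - (u : ℚ_[3]) ^ 2 = -(((u ^ 2 - 1 : ℤ) : ℚ_[3])) by push_cast; ring, norm_neg]
    exact (norm_intCast_le_of_pow_dvd (k := 1) (by rw [pow_one]; exact h3u2)).trans (by norm_num)
  have hTn : ‖T‖ ≤ 1 / 3 := by
    rw [show T = (T - T0) + T0 by ring]; exact (IsUltrametricDist.norm_add_le_max _ _).trans (max_le (hTT0.trans (by norm_num)) hT0n)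
  have hL := norm_padicLogSeries_add_cubic_le (y := t ^ 2) (by rw [← hT]; exact hTn)
  rw [← hT] at hL
  have hP := norm_cubicPoly_sub_le hTn hT0n
  have hU : (((u ^ 2 - 1 : ℤ)) : ℚ_[3]) = -T0 := by rw [hT0]; push_cast; ring
  rw [hU]
  have hsplit : (2 : ℚ_[3])⁻¹ * padicLogSeries 3 (t ^ 2) - (2 : ℚ_[3])⁻¹ * (-T0 - (-T0) ^ 2 / 2 + (-T0) ^ 3 / 3) =
      (2 : ℚ_[3])⁻¹ * ((padicLogSeries 3 (t ^ 2) + (T + T ^ 2 / 2 + T ^ 3 / 3)) -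
        ((T + T ^ 2 / 2 + T ^ 3 / 3) - (T0 + T0 ^ 2 / 2 + T0 ^ 3 / 3))) := by ring
  rw [hsplit, norm_mul, norm_inv_two₇, one_mul]
  refine (norm_sub_le_max₇ _ _).trans (max_le (hL.trans ?_) (hP.trans hTT0))
  calc ‖T‖ ^ 4 ≤ (1 / 3) ^ 4 := by gcongr
    _ = 1 / 81 := by norm_num

end Summit.BirchSwinnertonDyer.Rank1Residual.X11b.RegMult.KernelCert
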